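import Literature.NumberTheory.Automorphic.PairLFunctionNeConjOrthogonalLocalReduction
import Literature.NumberTheory.Automorphic.SmoothedFormCentralCharacter
import Summits.Langlands.Langlands.Theorems.IrreducibilityBySelfDualityPairLBoundaryJSGlobalPairGen
import Summits.Langlands.Langlands.Theorems.IrreducibilityBySelfDualityPairLBoundaryJSGlobalPairTwistedGen

/-!
# Crux `PairLBoundaryJS` (stmt-Langlands-13622), line `Sketch`, skeleton v8 — stub `stub_isOrtho_of_local_gen`

Route `IrreducibilityBySelfDuality`; lead prover c2. Leaf `hB` of `PairLBoundaryJS_of_moeglinWaldspurger_of_isOrtho`: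
`L^S(s, π × σ)` entire for ORTHOGONAL cuspidal pairs `π ⟂ σ̄`, reduced to ONE local Rankin–Selberg datum with a GENERAL
test function. The tree's reductions (`partialPairL_entire_of_isOrtho_conj_of_local`,
`exists_entire_eq_partialPairL_of_not_commonCentral_of_local`) FREEZE `Φ = Φ_∞ ⊗ 𝟙_{𝒪̂ⁿ}`, for which the twisted
road is vacuous as soon as `ω_π ω_σ` ramifies (`HlocNeIsOrthoFalse`, evidence of the item). Here the two global
theorems enter in their general-`Φ` form (`Φ ≥ 0` continuous, Schwartz–Bruhat, spherical off `S'`) as the LANDED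
stubs `GlobalPairGen.stub_global_pair_gen`, `GlobalPairTwistedGen.stub_global_pair_twisted_gen`, and `hloc` is the printed local theory with `Φ_{S'}` free
(JPSS (1983) Thm. 2.7; Jacquet–Shalika (1990); Humphries–Jo (2024)) for all pairs `π ≠ σ̄`, `π ⟂ σ̄`, no central
proviso. References: Mœglin–Waldspurger (1989), Appendice, Cor. (i)(b); Cogdell (2004), §2.3, §4.2; JPSS (1983), 2.7.
-/

noncomputable section

-- `Summit.Langlands.Langlands.…` (summit = sub-problem name, D-0017 layout) trips `dupNamespace`
set_option linter.dupNamespace false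

open scoped MatrixGroups Topology Pointwise ENNReal NNReal ComplexConjugate InnerProductSpace
open NumberField IsDedekindDomain MeasureTheory Measure Matrix Set Filter
open Literature.NumberTheory.Automorphic AdelicGroupData
open Literature.NumberTheory.GaloisRepresentations (ideleGroup HeckeCharacter)
open ValuativeRel

-- the automorphic quotient carries the tree's Borel σ-algebra, not Mathlib's quotient σ-algebra
attribute [-instance] Quotient.instMeasurableSpace QuotientGroup.measurableSpace

-- the house local instances, exactly as in `RankinSelbergUnfoldingIdentity`
attribute [local instance] adelicBorel borelSpace_adelic locallyCompactSpace_adelic secondCountableTopology_gl_adelic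
  glAdeleBorel borelSpace_glAdele borelSpace_ideleGroup secondCountableTopology_ideleGroup

namespace Summit.Langlands.Langlands.Theorems.IsOrthoOfLocalGen

/-- **Orthogonal pairs WITHOUT a common central action, general `Φ`.** The tree's
`exists_entire_eq_partialPairL_of_not_commonCentral_of_local` (Cogdell (2004) §2.3 p. 211, §4.2; Mœglin–Waldspurger
(1989), Cor. (i)(b)) verbatim with: `multiplicity_one_gl` ↦ `π ⟂ σ̄` in `hloc` (only passed on), a general test
function `Φ_i ≥ 0` (continuous, Schwartz–Bruhat, spherical off `S'_i`) in the local data, and the twisted global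
theorem as the HYPOTHESIS `hTw` (stub `stub_global_pair_twisted_gen`). Proof: `ω_π ≠ ω_{σ̄}`
(`exists_centralCharacter_smoothedForm`), `χ = ω_π ω_{σ̄}⁻¹ ≠ 1` unitary, trivial on `A_G`; `hTw` gives entire
`F_i = C A_i L^{S₀}` on the strip; `G = C⁻¹ B ∑ c_i F_i` equals `L^{S₀}` there (`eq_mul_partialPairL_of_eqOn_strip`). -/
theorem partialPairL_entire_of_not_commonCentral_gen {n : ℕ} {K : Type} [Field K] [NumberField K]
    {μ' : Measure (AdelicGroupData.gl n K).automorphicQuotient} [(AdelicGroupData.gl n K).IsAutomorphicMeasure μ']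
    [MeasurableSpace (AdeleRing (𝓞 K) K)] [BorelSpace (AdeleRing (𝓞 K) K)]
    (νI : Measure (ideleGroup K)) [νI.IsHaarMeasure] (νA : Measure (Fin n → ideleGroup K)) [IsHaarMeasure νA]
    (νK : Measure ↥(maximalCompactAdelic n K)) [IsHaarMeasure νK] (ν₀ : Measure ↥(adelicUnipotent n K)) [IsHaarMeasure ν₀]
    (hTw : ∀ {n : ℕ} {K : Type} [Field K] [NumberField K] [MeasurableSpace (AdeleRing (𝓞 K) K)] [BorelSpace (AdeleRing (𝓞
      K) K)] (_hn : 0 < n) (μ' : Measure (AdelicGroupData.gl n K).automorphicQuotient) [(AdelicGroupData.gl n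
      K).IsAutomorphicMeasure μ'] (νI : Measure (ideleGroup K)) [νI.IsHaarMeasure] (νA : Measure (Fin n → ideleGroup
      K)) [IsHaarMeasure νA] (νK : Measure ↥(maximalCompactAdelic n K)) [IsHaarMeasure νK] (ν₀ : Measure
      ↥(adelicUnipotent n K)) [IsHaarMeasure ν₀], ∃ C : ℝ, 0 < C ∧ ∀ (P Q : CuspidalAutomorphicRepGL n K μ') (f :
      P.1.toSubmodule) (f' : Q.1.toSubmodule) {ω ω' χ : HeckeCharacter K}, ω.IsUnitary → ω'.IsUnitary → χ = ω * ω'⁻¹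
      → χ ≠ 1 → ∀ (hχ₀ : ∀ t : ℝ≥0ˣ, χ (posRealIdele K t) = 1) {S : Set (HeightOneSpectrum (𝓞 K))} {α γ :
      SatakeFamily K}, IsSatakeFamilyOf P S α → IsSatakeFamilyOf Q S γ → ∀ {𝔫₀ : Ideal (𝓞 K)}, 𝔫₀ ≠ 0 → ∀ {θ :
      (AdelicGroupData.gl n K).Adelic → ℝ}, IsTestFunctionGL n K θ → (∀ k : (AdelicGroupData.gl n K).Adelic, k ∈
      principalCongruenceLevel n K 𝔫₀ → ∀ g : (AdelicGroupData.gl n K).Adelic, θ (k * g) = θ g) → (∀ (z : ideleGroup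
      K) (g : GL (Fin n) (AdeleRing (𝓞 K) K)), smoothedForm θ (f : (AdelicGroupData.gl n K).L2 μ')
      ((AdelicGroupData.gl n K).toAutomorphicQuotient (Matrix.GeneralLinearGroup.scalar (Fin n) z * g)) = ((ω z :
      ℂˣ) : ℂ)⁻¹ * smoothedForm θ (f : (AdelicGroupData.gl n K).L2 μ') ((AdelicGroupData.gl n
      K).toAutomorphicQuotient g)) → (∀ (z : ideleGroup K) (g : GL (Fin n) (AdeleRing (𝓞 K) K)), smoothedForm θ (f'
      : (AdelicGroupData.gl n K).L2 μ') ((AdelicGroupData.gl n K).toAutomorphicQuotient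
      (Matrix.GeneralLinearGroup.scalar (Fin n) z * g)) = ((ω' z : ℂˣ) : ℂ)⁻¹ * smoothedForm θ (f' :
      (AdelicGroupData.gl n K).L2 μ') ((AdelicGroupData.gl n K).toAutomorphicQuotient g)) → ∀ {S' : Set
      (HeightOneSpectrum (𝓞 K))}, S ⊆ S' → (∀ v ∉ S', ¬ v.asIdeal ∣ 𝔫₀ ∧ ¬ v.asIdeal ∣ differentIdeal ℤ (𝓞 K)) → ∀
      {x y : HeightOneSpectrum (𝓞 K) → Fin n → ℂ}, (∀ v ∉ S', (Finset.univ : Finset (Fin n)).val.map (x v) = α v) →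
      (∀ v ∉ S', (Finset.univ : Finset (Fin n)).val.map (y v) = γ v) → ∀ {Φ : (Fin n → AdeleRing (𝓞 K) K) → ℝ},
      Continuous Φ → (∀ y, 0 ≤ Φ y) → (fun y => ((Φ y : ℝ) : ℂ)) ∈ piSchwartzBruhat K (Fin n) → (∀ v ∉ S',
      IsLastRowSphericalAt n K Φ v) → (∀ v ∉ S', ∀ y : Fin n → AdeleRing (𝓞 K) K, Φ y ≠ 0 → ∀ j, Valued.v ((y j).2
      v) ≤ 1) → ∃ F : ℂ → ℂ, Differentiable ℂ F ∧ (∀ s : ℂ, 1 < s.re → F s = rankinSelbergIntegralTwisted μ' νI hχ₀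
      (fun y => ((Φ y : ℝ) : ℂ)) s (star (smoothedForm θ (f' : (AdelicGroupData.gl n K).L2 μ'))) (smoothedForm θ (f
      : (AdelicGroupData.gl n K).L2 μ'))) ∧ (∀ s : ℂ, 1 < s.re → s.re < 2 → F s = (C : ℂ) * (partialPairL S' α (fun
      v => (γ v).map conj) s * ∫ p in unitBox {v | v ∉ S'} ×ˢ Set.univ, torusPairIntegrandC n K (whittakerCoeff ν₀
      (unipotentTateDomain n K) (adeleAddChar K) (invQuot (AdelicGroupData.gl n K) (smoothedForm θ (f :
      (AdelicGroupData.gl n K).L2 μ')))) (star (whittakerCoeff ν₀ (unipotentTateDomain n K) (adeleAddChar K)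
      (invQuot (AdelicGroupData.gl n K) (smoothedForm θ (f' : (AdelicGroupData.gl n K).L2 μ'))))) Φ s p ∂(νA.prod
      νK))))
    (hloc : ∀ (_hn : 0 < n) (P P' : CuspidalAutomorphicRepGL n K μ') (_hne : P ≠ P'.conj) (_hor : P.1.toSubmodule ⟂
      P'.conj.1.toSubmodule) {S₀ : Set (HeightOneSpectrum (𝓞 K))} (_hS₀ : S₀.Finite) {α β : SatakeFamily K} (_hα :
      IsSatakeFamilyOf P S₀ α) (_hβ : IsSatakeFamilyOf P' S₀ β), ∃ (m : ℕ) (c : Fin m → ℂ) (f : Fin m →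
      P.1.toSubmodule) (f' : Fin m → P'.conj.1.toSubmodule) (𝔫₀ : Fin m → Ideal (𝓞 K)) (_h𝔫₀ : ∀ i, 𝔫₀ i ≠ 0) (η :
      Fin m → (AdelicGroupData.gl n K).Adelic → ℝ) (_hη : ∀ i, IsTestFunctionGL n K (η i)) (_hηK : ∀ i, ∀ k :
      (AdelicGroupData.gl n K).Adelic, k ∈ principalCongruenceLevel n K (𝔫₀ i) → ∀ g : (AdelicGroupData.gl n
      K).Adelic, η i (k * g) = η i g) (S' : Fin m → Set (HeightOneSpectrum (𝓞 K))) (hS'f : ∀ i, (S' i \ S₀).Finite)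
      (_hS₀S' : ∀ i, S₀ ⊆ S' i) (_hS' : ∀ i, ∀ v ∉ S' i, ¬ v.asIdeal ∣ 𝔫₀ i ∧ ¬ v.asIdeal ∣ differentIdeal ℤ (𝓞 K))
      (x y : Fin m → HeightOneSpectrum (𝓞 K) → Fin n → ℂ) (_hx : ∀ i, ∀ v ∉ S' i, (Finset.univ : Finset (Fin
      n)).val.map (x i v) = α v) (_hy : ∀ i, ∀ v ∉ S' i, (Finset.univ : Finset (Fin n)).val.map (y i v) = (β v).map
      conj) (Φ : Fin m → (Fin n → AdeleRing (𝓞 K) K) → ℝ) (_hΦc : ∀ i, Continuous (Φ i)) (_hΦ0 : ∀ i y, 0 ≤ Φ i y)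
      (_hΦS : ∀ i, (fun y => ((Φ i y : ℝ) : ℂ)) ∈ piSchwartzBruhat K (Fin n)) (_hΦsph : ∀ i, ∀ v ∉ S' i,
      IsLastRowSphericalAt n K (Φ i) v) (_hΦv : ∀ i, ∀ v ∉ S' i, ∀ y : Fin n → AdeleRing (𝓞 K) K, Φ i y ≠ 0 → ∀ j,
      Valued.v ((y j).2 v) ≤ 1) (B : ℂ → ℂ), Differentiable ℂ B ∧ ∀ s : ℂ, 1 < s.re → s.re < 2 → B s * (∑ i, c i *
      ((∏ v ∈ (hS'f i).toFinset, (satakePairPolynomial (α v) (β v)).eval ((v.residueCard : ℂ) ^ (-s))) * ∫ p in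
      unitBox {v | v ∉ S' i} ×ˢ Set.univ, torusPairIntegrandC n K (whittakerCoeff ν₀ (unipotentTateDomain n K)
      (adeleAddChar K) (invQuot (AdelicGroupData.gl n K) (smoothedForm (η i) ((f i : P.1.toSubmodule) :
      (AdelicGroupData.gl n K).L2 μ')))) (star (whittakerCoeff ν₀ (unipotentTateDomain n K) (adeleAddChar K)
      (invQuot (AdelicGroupData.gl n K) (smoothedForm (η i) ((f' i : P'.conj.1.toSubmodule) : (AdelicGroupData.gl n
      K).L2 μ'))))) (Φ i) s p ∂(νA.prod νK))) = 1)
    (hn : 0 < n) (P P' : CuspidalAutomorphicRepGL n K μ') (hne : P ≠ P'.conj) (hor : P.1.toSubmodule ⟂ P'.conj.1.toSubmodule)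
    (hω : ¬ (∀ z : ideleGroup K, ∃ c : ℂ, ‖c‖ = 1 ∧
      (∀ f : P.1.toSubmodule,
        (AdelicGroupData.gl n K).rightRegular μ' (Matrix.GeneralLinearGroup.scalar (Fin n) z)
            (f : (AdelicGroupData.gl n K).L2 μ') = c • (f : (AdelicGroupData.gl n K).L2 μ')) ∧
      (∀ f' : P'.conj.1.toSubmodule,
        (AdelicGroupData.gl n K).rightRegular μ' (Matrix.GeneralLinearGroup.scalar (Fin n) z)
            (f' : (AdelicGroupData.gl n K).L2 μ') = c • (f' : (AdelicGroupData.gl n K).L2 μ'))))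
    {S₀ : Set (HeightOneSpectrum (𝓞 K))} (hS₀ : S₀.Finite) {α β : SatakeFamily K}
    (hα : IsSatakeFamilyOf P S₀ α) (hβ : IsSatakeFamilyOf P' S₀ β) :
    ∃ g : ℂ → ℂ, Differentiable ℂ g ∧ ∀ s : ℂ, 1 < s.re → g s = partialPairL S₀ α β s := by
  classical
  -- the central characters of `π` and `σ̄` differ
  obtain ⟨ω, hωu, hωA, hωact, hωS, -, -⟩ := P.exists_centralCharacter_smoothedForm
  obtain ⟨ω', hω'u, hω'A, hω'act, hω'S, -, -⟩ := P'.conj.exists_centralCharacter_smoothedForm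
  have hωne : ω ≠ ω' := by
    intro hωeq
    refine hω fun z => ⟨((ω z : ℂˣ) : ℂ), hωu z, fun f => ?_, fun f' => ?_⟩
    · have h := congrArg Subtype.val (hωact z f)
      rw [ContRepresentation.ClosedSubrep.coe_toContRep_apply, Submodule.coe_smul] at h
      exact h
    · have h := congrArg Subtype.val (hω'act z f')
      rw [ContRepresentation.ClosedSubrep.coe_toContRep_apply, Submodule.coe_smul, ← hωeq] at h
      exact h
  set χ : HeckeCharacter K := ω * ω'⁻¹ with hχ
  have hχ1 : χ ≠ 1 := by
    intro h
    apply hωne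
    have h' := congrArg (· * ω') h
    simpa only [hχ, inv_mul_cancel_right, one_mul] using h'
  have hχ₀ : ∀ t : ℝ≥0ˣ, χ (posRealIdele K t) = 1 := fun t => by
    rw [hχ, HeckeCharacter.mul_apply, HeckeCharacter.inv_apply, hωA t, hω'A t, inv_one, mul_one]
  -- the local data and the twisted global theorem
  obtain ⟨m, c, f, f', 𝔫₀, h𝔫₀, η, hη, hηK, S', hS'f, hS₀S', hS', x, y, hx, hy, Φ, hΦc, hΦ0, hΦS, hΦsph, hΦv,
    B, hB, hBsum⟩ := hloc hn P P' hne hor hS₀ hα hβ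
  obtain ⟨C, hC, hT⟩ := hTw hn μ' νI νA νK ν₀
  choose F hF hFI hFstrip using fun i : Fin m => hT P P'.conj (f i) (f' i) hωu hω'u hχ hχ1 hχ₀ hα hβ.conj (h𝔫₀ i)
      (hη i) (hηK i) (fun z g => hωS (η i) (f i) z g) (fun z g => hω'S (η i) (f' i) z g) (hS₀S' i) (hS' i) (hx i)
      (hy i) (hΦc i) (hΦ0 i) (hΦS i) (hΦsph i) (hΦv i)
  -- `∑ c_i F_i = C · L^{S₀} · ∑ c_i A_i` on the strip
  have hββ : (fun v => ((β v).map conj).map conj) = β := funext fun v => multiset_map_conj_map_conj _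
  have hmul : ∀ (i : Fin m) (s : ℂ), 1 < s.re → Multipliable fun v : {v : HeightOneSpectrum (𝓞 K) // v ∉ S' i} =>
      ((satakePairPolynomial (α v.1) (β v.1)).eval ((v.1.residueCard : ℂ) ^ (-s)))⁻¹ := fun i s hs =>
    JacquetShalika1981_multipliable_partialPairL_holds P P' (hα.mono (hS₀S' i)) (hβ.mono (hS₀S' i)) hs
  have hPne : ∀ (i : Fin m) (s : ℂ), 1 < s.re → ∀ v ∈ (hS'f i).toFinset,
      (satakePairPolynomial (α v) (β v)).eval ((v.residueCard : ℂ) ^ (-s)) ≠ 0 := fun i s hs v hv =>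
    eval_satakePairPolynomial_ne_zero_of_one_lt_re P P' hα hβ ((hS'f i).mem_toFinset.1 hv).2 hs
  have hsum : ∀ s : ℂ, 1 < s.re → s.re < 2 → ∑ i, c i * F i s = ((C : ℂ) * partialPairL S₀ α β s) * ∑ i, c i * ((∏ v
      ∈ (hS'f i).toFinset, (satakePairPolynomial (α v) (β v)).eval ((v.residueCard : ℂ) ^ (-s))) * ∫ p in unitBox {v
      | v ∉ S' i} ×ˢ Set.univ, torusPairIntegrandC n K (whittakerCoeff ν₀ (unipotentTateDomain n K) (adeleAddChar K)
      (invQuot (AdelicGroupData.gl n K) (smoothedForm (η i) ((f i : P.1.toSubmodule) : (AdelicGroupData.gl n K).L2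
      μ')))) (star (whittakerCoeff ν₀ (unipotentTateDomain n K) (adeleAddChar K) (invQuot (AdelicGroupData.gl n K)
      (smoothedForm (η i) ((f' i : P'.conj.1.toSubmodule) : (AdelicGroupData.gl n K).L2 μ'))))) (Φ i) s p ∂(νA.prod
      νK)) := by
    intro s hs1 hs2
    rw [Finset.mul_sum]
    refine Finset.sum_congr rfl fun i _ => ?_
    have h := hFstrip i s hs1 hs2
    beta_reduce at h
    rw [hββ] at h
    have hP0 : (∏ v ∈ (hS'f i).toFinset,
                (satakePairPolynomial (α v) (β v)).eval ((v.residueCard : ℂ) ^ (-s))) ≠ 0 :=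
      Finset.prod_ne_zero_iff.2 (hPne i s hs1)
    rw [h, partialPairL_eq_prod_mul_partialPairL (hS₀S' i) (hS'f i) α β (hmul i s hs1), Finset.prod_inv_distrib]
    field_simp
  -- the entire function `G = C⁻¹ B ∑ c_i F_i`
  set G : ℂ → ℂ := fun s => (C : ℂ)⁻¹ * (B s * ∑ i, c i * F i s) with hGdef
  have hC0 : (C : ℂ) ≠ 0 := Complex.ofReal_ne_zero.2 hC.ne'
  have hsumF : Differentiable ℂ fun s => ∑ i, c i * F i s := by
    have h : Differentiable ℂ (∑ i, fun s => c i * F i s) := Differentiable.sum fun i _ => (hF i).const_mul (c i)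
    convert h using 1
    funext s
    simp only [Finset.sum_apply]
  have hG : Differentiable ℂ G := by
    show Differentiable ℂ fun s => (C : ℂ)⁻¹ * (B s * ∑ i, c i * F i s)
    exact (hB.mul hsumF).const_mul _
  have hGstrip : ∀ s : ℂ, 1 < s.re → s.re < 2 → G s = (fun _ : ℂ => (1 : ℂ)) s * partialPairL S₀ α β s := by
    intro s hs1 hs2
    have h1 := hBsum s hs1 hs2
    show (C : ℂ)⁻¹ * (B s * ∑ i, c i * F i s) = 1 * partialPairL S₀ α β s
    rw [hsum s hs1 hs2, mul_left_comm (B s), h1, mul_one]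
    field_simp
  have hGL : ∀ s : ℂ, 1 < s.re → G s = (fun _ : ℂ => (1 : ℂ)) s * partialPairL S₀ α β s :=
    eq_mul_partialPairL_of_eqOn_strip P P' hα hβ hG (differentiable_const _) hGstrip
  exact ⟨G, hG, fun s hs => by rw [hGL s hs, one_mul]⟩

/-- **Registered stub `stub_isOrtho_of_local_gen` of the crux skeleton `PairLBoundaryJS` (line `Sketch`, v8): the
orthogonal-pair continuation from the two general-`Φ` global theorems and ONE general-`Φ` local datum.** For
cuspidal `π ⟂ σ̄` in one `L²_cusp(GL_n)` (`0 < n`), every finite `S` and Satake families off `S`, `L^S(s, π × σ)`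
extends to an entire function — granted `hloc` (local theory for the orthogonal pairs `π ≠ σ̄`, general `Φ_{S'}`,
no central proviso, stub `stub_hloc_ne_gen`); the global Rankin–Selberg pair theorem for a general test function and
its twisted form are the LANDED stubs `GlobalPairGen.stub_global_pair_gen`, `GlobalPairTwistedGen.stub_global_pair_twisted_gen`. Proof: that of
`partialPairL_entire_of_isOrtho_conj_of_local'` + `…_of_local` verbatim — Borel structure `borel _` and Haar measures
chosen inside; orthogonal representations are distinct; reduction to the ramified datum
(`exists_entire_eq_partialPairL_of_ramified_datum`); no common central action ↦
`partialPairL_entire_of_not_commonCentral_gen`; otherwise `stub_global_pair_gen` supplies entire `F_i` factorised on the strip, both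
residues vanish by orthogonality (`apply_one_eq_zero_…_of_isOrtho`, `apply_zero_eq_zero_…_of_isOrtho`, any
Schwartz–Bruhat `Φ`), and `G = C⁻¹ B ∑ c_i F_i` continues `s (s - 1) L^{S₀}` with zeros at `0`, `1`. -/
theorem stub_isOrtho_of_local_gen :
    ∀ {n : ℕ} {K : Type} [Field K] [NumberField K]
      {μ : Measure (AdelicGroupData.gl n K).automorphicQuotient}
      [(AdelicGroupData.gl n K).IsAutomorphicMeasure μ],
      (∀ [MeasurableSpace (AdeleRing (𝓞 K) K)] [BorelSpace (AdeleRing (𝓞 K) K)]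
      (νA : Measure (Fin n → ideleGroup K)) [IsHaarMeasure νA]
      (νK : Measure ↥(maximalCompactAdelic n K)) [IsHaarMeasure νK]
      (ν₀ : Measure ↥(adelicUnipotent n K)) [IsHaarMeasure ν₀],
      ∀ (_hn : 0 < n)
      (P P' : CuspidalAutomorphicRepGL n K μ) (_hne : P ≠ P'.conj)
      (_hor : P.1.toSubmodule ⟂ P'.conj.1.toSubmodule)
      {S₀ : Set (HeightOneSpectrum (𝓞 K))} (_hS₀ : S₀.Finite) {α β : SatakeFamily K}
      (_hα : IsSatakeFamilyOf P S₀ α) (_hβ : IsSatakeFamilyOf P' S₀ β),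
      ∃ (m : ℕ) (c : Fin m → ℂ) (f : Fin m → P.1.toSubmodule) (f' : Fin m → P'.conj.1.toSubmodule)
      (𝔫₀ : Fin m → Ideal (𝓞 K)) (_h𝔫₀ : ∀ i, 𝔫₀ i ≠ 0)
      (η : Fin m → (AdelicGroupData.gl n K).Adelic → ℝ) (_hη : ∀ i, IsTestFunctionGL n K (η i))
      (_hηK : ∀ i, ∀ k : (AdelicGroupData.gl n K).Adelic, k ∈ principalCongruenceLevel n K (𝔫₀ i) →
      ∀ g : (AdelicGroupData.gl n K).Adelic, η i (k * g) = η i g)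
      (S' : Fin m → Set (HeightOneSpectrum (𝓞 K))) (hS'f : ∀ i, (S' i \ S₀).Finite) (_hS₀S' : ∀ i, S₀ ⊆ S' i)
      (_hS' : ∀ i, ∀ v ∉ S' i, ¬ v.asIdeal ∣ 𝔫₀ i ∧ ¬ v.asIdeal ∣ differentIdeal ℤ (𝓞 K))
      (x y : Fin m → HeightOneSpectrum (𝓞 K) → Fin n → ℂ)
      (_hx : ∀ i, ∀ v ∉ S' i, (Finset.univ : Finset (Fin n)).val.map (x i v) = α v)
      (_hy : ∀ i, ∀ v ∉ S' i, (Finset.univ : Finset (Fin n)).val.map (y i v) = (β v).map conj)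
      (Φ : Fin m → (Fin n → AdeleRing (𝓞 K) K) → ℝ) (_hΦc : ∀ i, Continuous (Φ i))
      (_hΦ0 : ∀ i y, 0 ≤ Φ i y)
      (_hΦS : ∀ i, (fun y => ((Φ i y : ℝ) : ℂ)) ∈ piSchwartzBruhat K (Fin n))
      (_hΦsph : ∀ i, ∀ v ∉ S' i, IsLastRowSphericalAt n K (Φ i) v)
      (_hΦv : ∀ i, ∀ v ∉ S' i, ∀ y : Fin n → AdeleRing (𝓞 K) K, Φ i y ≠ 0 → ∀ j, Valued.v ((y j).2 v) ≤ 1)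
      (B : ℂ → ℂ), Differentiable ℂ B ∧
      ∀ s : ℂ, 1 < s.re → s.re < 2 →
      B s * (∑ i, c i * ((∏ v ∈ (hS'f i).toFinset,
      (satakePairPolynomial (α v) (β v)).eval ((v.residueCard : ℂ) ^ (-s))) *
      ∫ p in unitBox {v | v ∉ S' i} ×ˢ Set.univ, torusPairIntegrandC n K
      (whittakerCoeff ν₀ (unipotentTateDomain n K) (adeleAddChar K)
      (invQuot (AdelicGroupData.gl n K) (smoothedForm (η i) ((f i : P.1.toSubmodule) : (AdelicGroupData.gl n K).L2 μ))))
      (star (whittakerCoeff ν₀ (unipotentTateDomain n K) (adeleAddChar K)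
      (invQuot (AdelicGroupData.gl n K) (smoothedForm (η i) ((f' i : P'.conj.1.toSubmodule) : (AdelicGroupData.gl n K).L2 μ)))))
      (Φ i) s p ∂(νA.prod νK))) = 1) →
      ∀ (_hn : 0 < n) (P P' : CuspidalAutomorphicRepGL n K μ)
      (_hor : P.1.toSubmodule ⟂ P'.conj.1.toSubmodule)
      {S : Set (HeightOneSpectrum (𝓞 K))} (_hS : S.Finite) {α β : SatakeFamily K}
      (_hα : IsSatakeFamilyOf P S α) (_hβ : IsSatakeFamilyOf P' S β),
      ∃ g : ℂ → ℂ, Differentiable ℂ g ∧ ∀ s : ℂ, 1 < s.re → g s = partialPairL S α β s := by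
  intro n K _ _ μ' _ hloc hn P P' hor S hS α β hα hβ
  classical
  -- topological and measurable structures (verbatim `…_of_eq_conj_of_local`)
  haveI : T2Space (GL (Fin n) (AdeleRing (𝓞 K) K)) := t2Space_gl n K
  haveI : LocallyCompactSpace (GL (Fin n) (AdeleRing (𝓞 K) K)) :=
    AdelicGroupData.locallyCompactSpace_generalLinearGroup_adeleRing K (Fin n)
  haveI := secondCountableTopology_generalLinearGroup_adeleRing K (Fin n)
  haveI : T2Space (AdeleRing (𝓞 K) K) := t2Space_adeleRing K
  letI : MeasurableSpace (AdeleRing (𝓞 K) K) := borel _; haveI : BorelSpace (AdeleRing (𝓞 K) K) := ⟨rfl⟩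
  haveI := borelSpace_ideleGroup K; haveI := locallyCompactSpace_ideleGroup K
  haveI := secondCountableTopology_ideleGroup K; haveI := secondCountableTopology_adeleRing K
  haveI := locallyCompactSpace_adeleRing' K
  haveI : CompactSpace ↥(maximalCompactAdelic n K) := isCompact_iff_compactSpace.1 (isCompact_maximalCompactAdelic n K)
  haveI : LocallyCompactSpace ↥(adelicUnipotent n K) := (isClosed_adelicUnipotent n K).locallyCompactSpace
  -- Haar measures (`ν_I` from `exists_isHaarMeasure_ideleGroup`, the others `Measure.haar`), and the local datum at them
  obtain ⟨νI, hνI⟩ := exists_isHaarMeasure_ideleGroup K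
  set νA : Measure (Fin n → ideleGroup K) := Measure.haar with hνA
  set νK : Measure ↥(maximalCompactAdelic n K) := Measure.haar with hνK
  set ν₀ : Measure ↥(adelicUnipotent n K) := Measure.haar with hν₀
  have hloc' := hloc νA νK ν₀
  -- orthogonal representations are distinct (`π` is non-zero, hence not orthogonal to itself)
  have hne : P ≠ P'.conj := by
    intro h
    have hPbot : P.1 ≠ ⊥ := ((P.1.isTopIrreducible_toContRep_iff).1 P.isTopIrreducible).1
    obtain ⟨g, hg, hg0⟩ : ∃ g ∈ P.1.toSubmodule, g ≠ 0 := by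
      by_contra hall
      push Not at hall
      exact hPbot (le_bot_iff.1 fun g hg => by
        rw [ContRepresentation.ClosedSubrep.mem_bot]; exact hall g hg)
    have h0 : ⟪g, g⟫_ℂ = 0 := (Submodule.isOrtho_iff_inner_eq.1 hor) g hg g (by rw [← h]; exact hg)
    exact hg0 (inner_self_eq_zero.1 h0)
  -- reduction to the ramified datum (change of `S`, uniqueness of Satake parameters)
  obtain ⟨α₀, β₀, hα₀, hβ₀⟩ := exists_isSatakeFamilyOf_pair_ramified P P'
  have hS₀ : {v : HeightOneSpectrum (𝓞 K) | ¬ IsUnramifiedAt P.1 v ∨ ¬ IsUnramifiedAt P'.1 v}.Finite :=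
    finite_setOf_not_isUnramifiedAt_or P P'
  set S₀ : Set (HeightOneSpectrum (𝓞 K)) := {v | ¬ IsUnramifiedAt P.1 v ∨ ¬ IsUnramifiedAt P'.1 v} with hS₀def
  refine exists_entire_eq_partialPairL_of_ramified_datum P P' (S₀ := S₀) (fun v hv => hv) hα₀ hβ₀ ?_ hS hα hβ
  -- pairs without a common central action: the twisted input
  by_cases hω : (∀ z : ideleGroup K, ∃ c : ℂ, ‖c‖ = 1 ∧ (∀ f : P.1.toSubmodule, (AdelicGroupData.gl n
      K).rightRegular μ' (Matrix.GeneralLinearGroup.scalar (Fin n) z) (f : (AdelicGroupData.gl n K).L2 μ') = c • (f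
      : (AdelicGroupData.gl n K).L2 μ')) ∧ (∀ f' : P'.conj.1.toSubmodule, (AdelicGroupData.gl n K).rightRegular μ'
      (Matrix.GeneralLinearGroup.scalar (Fin n) z) (f' : (AdelicGroupData.gl n K).L2 μ') = c • (f' :
      (AdelicGroupData.gl n K).L2 μ')))
  swap
  · exact partialPairL_entire_of_not_commonCentral_gen νI νA νK ν₀ GlobalPairTwistedGen.stub_global_pair_twisted_gen hloc'
      hn P P' hne hor hω hS₀ hα₀ hβ₀
  -- the global theorem and the local data
  obtain ⟨C, hC, hT⟩ := GlobalPairGen.stub_global_pair_gen hn μ' νI νA νK ν₀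
  obtain ⟨m, c, f, f', 𝔫₀, h𝔫₀, η, hη, hηK, S', hS'f, hS₀S', hS', x, y, hx, hy, Φ, hΦc, hΦ0, hΦS, hΦsph, hΦv,
    B, hB, hBsum⟩ := hloc' hn P P' hne hor hS₀ hα₀ hβ₀
  have hZ : ∀ (i : Fin m) (z : ideleGroup K), ∃ c : ℂ, ‖c‖ = 1 ∧ (AdelicGroupData.gl n K).rightRegular μ'
      (Matrix.GeneralLinearGroup.scalar (Fin n) z) ((f i : P.1.toSubmodule) : (AdelicGroupData.gl n K).L2 μ') = c •
      ((f i : P.1.toSubmodule) : (AdelicGroupData.gl n K).L2 μ') ∧ (AdelicGroupData.gl n K).rightRegular μ'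
      (Matrix.GeneralLinearGroup.scalar (Fin n) z) ((f' i : P'.conj.1.toSubmodule) : (AdelicGroupData.gl n K).L2 μ')
      = c • ((f' i : P'.conj.1.toSubmodule) : (AdelicGroupData.gl n K).L2 μ') := fun i z => by
    obtain ⟨d, hd, hP, hQ⟩ := hω z
    exact ⟨d, hd, hP (f i), hQ (f' i)⟩
  choose F hF hFI hFstrip using fun i : Fin m => hT P P'.conj (f i) (f' i) (hZ i) hα₀ hβ₀.conj (h𝔫₀ i) (hη i) (hηK
      i) (hS₀S' i) (hS' i) (hx i) (hy i) (hΦc i) (hΦ0 i) (hΦS i) (hΦsph i) (hΦv i)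
  -- the residues of every `F_i` at `s = 1` and `s = 0`
  have hF1' : ∀ i, F i 1 = 0 := fun i => apply_one_eq_zero_of_entire_eq_mul_rankinSelbergIntegral_of_isOrtho hn νI P
      P'.conj hor.symm (f i) (f' i) (hη i) (hΦS i) (hF i) (hFI i)
  have hF0' : ∀ i, F i 0 = 0 := fun i => apply_zero_eq_zero_of_entire_eq_mul_rankinSelbergIntegral_of_isOrtho hn νI
      P P'.conj hor.symm (f i) (f' i) (hη i) (hΦS i) (hF i) (hFI i)
  -- `∑ c_i F_i = s (s - 1) · C · L^{S₀} · ∑ c_i A_i` on the strip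
  have hββ : (fun v => ((β₀ v).map conj).map conj) = β₀ := funext fun v => multiset_map_conj_map_conj _
  have hmul : ∀ (i : Fin m) (s : ℂ), 1 < s.re → Multipliable fun v : {v : HeightOneSpectrum (𝓞 K) // v ∉ S' i} =>
      ((satakePairPolynomial (α₀ v.1) (β₀ v.1)).eval ((v.1.residueCard : ℂ) ^ (-s)))⁻¹ := fun i s hs =>
    JacquetShalika1981_multipliable_partialPairL_holds P P' (hα₀.mono (hS₀S' i)) (hβ₀.mono (hS₀S' i)) hs
  have hPne : ∀ (i : Fin m) (s : ℂ), 1 < s.re → ∀ v ∈ (hS'f i).toFinset,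
      (satakePairPolynomial (α₀ v) (β₀ v)).eval ((v.residueCard : ℂ) ^ (-s)) ≠ 0 := fun i s hs v hv =>
    eval_satakePairPolynomial_ne_zero_of_one_lt_re P P' hα₀ hβ₀ ((hS'f i).mem_toFinset.1 hv).2 hs
  have hsum : ∀ s : ℂ, 1 < s.re → s.re < 2 → ∑ i, c i * F i s = (s * (s - 1) * (C : ℂ) * partialPairL S₀ α₀ β₀ s) *
      ∑ i, c i * ((∏ v ∈ (hS'f i).toFinset, (satakePairPolynomial (α₀ v) (β₀ v)).eval ((v.residueCard : ℂ) ^ (-s)))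
      * ∫ p in unitBox {v | v ∉ S' i} ×ˢ Set.univ, torusPairIntegrandC n K (whittakerCoeff ν₀ (unipotentTateDomain n
      K) (adeleAddChar K) (invQuot (AdelicGroupData.gl n K) (smoothedForm (η i) ((f i : P.1.toSubmodule) :
      (AdelicGroupData.gl n K).L2 μ')))) (star (whittakerCoeff ν₀ (unipotentTateDomain n K) (adeleAddChar K)
      (invQuot (AdelicGroupData.gl n K) (smoothedForm (η i) ((f' i : P'.conj.1.toSubmodule) : (AdelicGroupData.gl n
      K).L2 μ'))))) (Φ i) s p ∂(νA.prod νK)) := by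
    intro s hs1 hs2
    rw [Finset.mul_sum]
    refine Finset.sum_congr rfl fun i _ => ?_
    have h := hFstrip i s hs1 hs2
    beta_reduce at h
    rw [hββ] at h
    have hP0 : (∏ v ∈ (hS'f i).toFinset,
                (satakePairPolynomial (α₀ v) (β₀ v)).eval ((v.residueCard : ℂ) ^ (-s))) ≠ 0 :=
      Finset.prod_ne_zero_iff.2 (hPne i s hs1)
    rw [h, partialPairL_eq_prod_mul_partialPairL (hS₀S' i) (hS'f i) α₀ β₀ (hmul i s hs1), Finset.prod_inv_distrib]
    field_simp
  -- the entire function `G = C⁻¹ B ∑ c_i F_i`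
  set G : ℂ → ℂ := fun s => (C : ℂ)⁻¹ * (B s * ∑ i, c i * F i s) with hGdef
  have hC0 : (C : ℂ) ≠ 0 := Complex.ofReal_ne_zero.2 hC.ne'
  have hsumF : Differentiable ℂ fun s => ∑ i, c i * F i s := by
    have h : Differentiable ℂ (∑ i, fun s => c i * F i s) := Differentiable.sum fun i _ => (hF i).const_mul (c i)
    convert h using 1
    funext s
    simp only [Finset.sum_apply]
  have hG : Differentiable ℂ G := by
    show Differentiable ℂ fun s => (C : ℂ)⁻¹ * (B s * ∑ i, c i * F i s)
    exact (hB.mul hsumF).const_mul _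
  have hGstrip : ∀ s : ℂ, 1 < s.re → s.re < 2 → G s = s * (s - 1) * partialPairL S₀ α₀ β₀ s := by
    intro s hs1 hs2
    have h1 := hBsum s hs1 hs2
    show (C : ℂ)⁻¹ * (B s * ∑ i, c i * F i s) = _
    rw [hsum s hs1 hs2, mul_left_comm (B s), h1, mul_one]
    field_simp
  have hGL : ∀ s : ℂ, 1 < s.re → G s = s * (s - 1) * partialPairL S₀ α₀ β₀ s :=
    eq_mul_partialPairL_of_eqOn_strip P P' hα₀ hβ₀ hG (differentiable_id.mul (differentiable_id.sub_const 1)) hGstrip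
  have hG1 : G 1 = 0 := by
    show (C : ℂ)⁻¹ * (B 1 * ∑ i, c i * F i 1) = 0
    rw [Finset.sum_eq_zero fun i _ => by rw [hF1' i, mul_zero], mul_zero, mul_zero]
  have hG0 : G 0 = 0 := by
    show (C : ℂ)⁻¹ * (B 0 * ∑ i, c i * F i 0) = 0
    rw [Finset.sum_eq_zero fun i _ => by rw [hF0' i, mul_zero], mul_zero, mul_zero]
  exact exists_entire_eq_of_entire_mul_of_apply_eq_zero hG hG0 hG1 hGL

end Summit.Langlands.Langlands.Theorems.IsOrthoOfLocalGen

end
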